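import Summits.Ventures.GridStability.Lyapunov.StructurePreservingPolytopeRoa
import Summits.Ventures.GridStability.Lyapunov.StructurePreservingPolytopeLevel
import Literature.MathematicalPhysics.PowerSystems.PowerFlowEquilibriumExistence
import HarnessLib

/-!
# GridStability/Lyapunov/StructurePreservingSwitchKit — the SWITCHING certificate of the
# structure-preserving model: after the couplings of an edge-list instance change from `w⁰` to `w¹`
# (a branch opened, a double outage, a reclosure) with the injections `P⁰ := f⁰(δ₀)` KEPT, ONE
# decidable rational check certifies (i) a synchronous equilibrium of the post-switch model EXISTS
# (enclosed), and — file 2, `StructurePreservingSwitchRoa` — (ii) the post-switch motion from the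
# pre-switch synchronous state re-synchronises inside Vu–Turitsyn's polytope

Cell `gridfusion` (LADDER-GRIDFUSION), seat gridfusion-lyap-1 (g9), line «G2.b-NE39SP-N1-SWITCH»
(simulation-free contingency screening in the sense of [cite: VuTuritsyn2016, §VI]: «the post-fault
dynamics is certified stable if the fault-cleared state stays within the polytope and V < V_min»; here
the cleared state is the PRE-switch equilibrium and the certificate is a kernel theorem). MODEL MV-3
(`plan/MODEL-VALIDITY.md`): model-2's `StructurePreserving.Params` on an INDEXED EDGE LIST
(`b = symmetrize (edgeWeight src tgt w)`, `Models/StructurePreservingInstance.lean`), equilibria at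
half-angle points `δ = halfAngle t` (`t` = rational half-angle tangents).

WHAT IS HERE (generic in `n` nodes, `m` listed edges, reference node `r`; no instance literal):
* `Switch.Cert` — the rational certificate: post-switch approximate tangents `t1`, a positive vector
  `x` (Collatz–Barta supersolution of the grounded coupling Laplacian), scalars `τ1 ≤ τγ < 1`
  (post-switch window / margin tangent), `R` (enclosure radius), `μ` (coercivity), `c` (energy level);
* `Switch.Cert.check` — ONE decidable conjunction over `ℚ` (margin; per listed edge: signs, no
  self-loop, tangent products, post-switch window `|q¹ₑ| ≤ τ1`, pre-switch window `|q⁰ₑ| ≤ 1`, level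
  `c < w¹ₑ·(2cos γ − 3.141593·sin γ)`; per node: `xᵢ > 0` and `μxᵢ ≤ cos γ·(L¹x)ᵢ` off `r`; the residual
  `4Σ_{i≠r}(f⁰ᵢ(δ₀) − f¹ᵢ(θ̃))² < μ²R²`; the energy budget `Σₑ w¹ₑ·2(|dₑ| + R)² ≤ c`), meant for
  `decide +kernel` in an instance file;
* cast lemmas (`flowQ` = the real injections at a half-angle point, `lapQ` = the Laplacian action),
  the scalar lemmas `le_arctan_of_mul_le` / `abs_arctan_le_abs`, and edge-list plumbing
  (`exists_ne_zero_edge`, `symmetrize_edgeWeight_self`, `half_sum_symmetrize`).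
File 2 `StructurePreservingSwitchExist.lean`: connectivity and coercivity from the supersolution
(lit-1's `ClassicalModel.coercive_of_supersolution` [cite: BermanPlemmons1994, Ch. 6 Thm 2.3]) and
EXISTENCE of the post-switch equilibrium (lit-1's `exists_equilibrium_of_residual_reference`
[cite: DvijothamLowChertkov2015, §3.3 Corollary 1]); file 3 `StructurePreservingSwitchRoa.lean`: the
energy budget and RE-SYNCHRONISATION from the pre-switch state [cite: VuTuritsyn2016, §IV, §VI].
THREE COLUMNS: mathematics about MODEL MV-3; a certificate format and its soundness; no sentence here
says any grid is stable. Two small definitions of rational bookkeeping functions + one structure; no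
named fact; standard axioms.
-/

noncomputable section

open Set Filter Topology Real Finset
open Summit.Ventures.GridStability.Models.StructurePreserving
open Summit.Ventures.GridStability.Models.StructurePreserving.Params
open Literature.MathematicalPhysics.PowerSystems

namespace Summit.Ventures.GridStability.Lyapunov.StructurePreserving.Switch

variable {n m : ℕ}

/-! ### Rational bookkeeping functions (computable; evaluated by the kernel) -/

section RatDefs

/-- Rational sine of a half-angle: `sin(2·arctan x) = 2x/(1 + x²)`. [folklore] -/
def hsin {K : Type*} [Field K] (x : K) : K := 2 * x / (1 + x ^ 2)

/-- Rational cosine of a half-angle: `cos(2·arctan x) = (1 − x²)/(1 + x²)`. [folklore] -/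
def hcos {K : Type*} [Field K] (x : K) : K := (1 - x ^ 2) / (1 + x ^ 2)

/-- `sin(2·arctan a − 2·arctan b)` as a rational function. [folklore] -/
def sinSub {K : Type*} [Field K] (a b : K) : K := hsin a * hcos b - hcos a * hsin b

/-- Half-angle tangent of a difference: `tan(α − β) = (a − b)/(1 + ab)` for `a = tan α`, `b = tan β`.
[folklore] -/
def quot {K : Type*} [Field K] (a b : K) : K := (a - b) / (1 + a * b)

/-- Injections of edge-list couplings `w` at the half-angle point of `t`, node `i`:
`Σₑ wₑ([src e = i]·sin(δᵢ − δ_tgt) + [tgt e = i]·sin(δᵢ − δ_src))` over `K`. [folklore] -/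
def flowQ {K : Type*} [Field K] (src tgt : Fin m → Fin n) (w : Fin m → K) (t : Fin n → K)
    (i : Fin n) : K :=
  ∑ e, w e * ((if src e = i then sinSub (t i) (t (tgt e)) else 0)
    + (if tgt e = i then sinSub (t i) (t (src e)) else 0))

/-- Action of the coupling Laplacian of edge-list couplings `w` on a node vector `x`, node `i`:
`Σⱼ bᵢⱼ(xᵢ − xⱼ) = Σₑ wₑ([src e = i](xᵢ − x_tgt) + [tgt e = i](xᵢ − x_src))`. [folklore] -/
def lapQ {K : Type*} [Field K] (src tgt : Fin m → Fin n) (w : Fin m → K) (x : Fin n → K)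
    (i : Fin n) : K :=
  ∑ e, w e * ((if src e = i then x i - x (tgt e) else 0) + (if tgt e = i then x i - x (src e) else 0))

end RatDefs

/-- **The switching certificate** (rational data): `t1` approximate post-switch equilibrium
half-angle tangents, `x` a positive node vector (supersolution), `τ1` post-switch window tangent, `τγ`
margin tangent (`γ = 2·arctan τγ`), `R` enclosure radius, `μ` coercivity constant, `c` energy level.
MODELLED bookkeeping; no claim. [folklore] -/
structure Cert (n m : ℕ) where
  /-- approximate post-switch equilibrium, half-angle tangents -/
  t1 : Fin n → ℚ
  /-- positive supersolution of the grounded coupling Laplacian -/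
  x : Fin n → ℚ
  /-- post-switch window tangent: `|q¹ₑ| ≤ τ1` on coupled edges -/
  τ1 : ℚ
  /-- margin tangent, `γ = 2·arctan τγ` -/
  τγ : ℚ
  /-- enclosure radius (rad) -/
  R : ℚ
  /-- coercivity constant -/
  μ : ℚ
  /-- energy level of the certified invariant set -/
  c : ℚ

/-- **The ONE decidable check of a switching certificate** against edge-list data (`src`, `tgt`,
pre-switch weights `w0`, post-switch weights `w1`, pre-switch equilibrium tangents `t0`, reference
node `r`). Conjuncts: scalar signs and the margin `R(1 + u²) ≤ u`, `u = quot τγ τ1` (so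
`2·arctan τ1 + 2R ≤ γ`); per listed edge: `w0, w1 ≥ 0`, no self-loop, and unless `w1ₑ = 0`: tangent
products `> −1`, post-switch window `|q¹ₑ| ≤ τ1`, pre-switch window `|q⁰ₑ| ≤ 1`, `q⁰ₑq¹ₑ > −1`, and the
uniform polytope level `c < w1ₑ·(2cos γ − 3.141593·sin γ)`; per node: `xᵢ > 0` and off the reference
`μxᵢ ≤ cos γ·(L¹x)ᵢ`; the residual `4Σ_{i ≠ r}(f⁰ᵢ − f¹ᵢ(θ̃))² < μ²R²`; the energy budget
`Σₑ w1ₑ·2(|quot q⁰ₑ q¹ₑ| + R)² ≤ c`. An `abbrev`, so `decide` sees the conjunction. [folklore] -/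
abbrev Cert.check (C : Cert n m) (src tgt : Fin m → Fin n) (w0 w1 : Fin m → ℚ) (t0 : Fin n → ℚ)
    (r : Fin n) : Prop :=
  (0 < C.R ∧ 0 < C.μ ∧ 0 ≤ C.τ1 ∧ C.τ1 ≤ C.τγ ∧ C.τγ < 1 ∧
    C.R * (1 + quot C.τγ C.τ1 ^ 2) ≤ quot C.τγ C.τ1) ∧
  (∀ e, 0 ≤ w0 e ∧ 0 ≤ w1 e ∧ src e ≠ tgt e ∧
    (w1 e = 0 ∨
      (-1 < C.t1 (src e) * C.t1 (tgt e) ∧ |quot (C.t1 (src e)) (C.t1 (tgt e))| ≤ C.τ1 ∧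
        -1 < t0 (src e) * t0 (tgt e) ∧ |quot (t0 (src e)) (t0 (tgt e))| ≤ 1 ∧
        -1 < quot (t0 (src e)) (t0 (tgt e)) * quot (C.t1 (src e)) (C.t1 (tgt e)) ∧
        C.c < w1 e * (2 * hcos C.τγ - 3141593 / 1000000 * hsin C.τγ)))) ∧
  (∀ i, 0 < C.x i ∧ (i ≠ r → C.μ * C.x i ≤ hcos C.τγ * lapQ src tgt w1 C.x i)) ∧
  4 * (∑ i ∈ univ.erase r, (flowQ src tgt w0 t0 i - flowQ src tgt w1 C.t1 i) ^ 2)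
      < C.μ ^ 2 * C.R ^ 2 ∧
  (∑ e, w1 e * (2 * (|quot (quot (t0 (src e)) (t0 (tgt e)))
      (quot (C.t1 (src e)) (C.t1 (tgt e)))| + C.R) ^ 2)) ≤ C.c

/-! ### Cast lemmas: the rational functions ARE the real trigonometric quantities -/

/-- `hsin` commutes with the cast. [folklore] -/
theorem hsin_cast (x : ℚ) : ((hsin x : ℚ) : ℝ) = hsin (x : ℝ) := by
  unfold hsin; push_cast; rfl

/-- `hcos` commutes with the cast. [folklore] -/
theorem hcos_cast (x : ℚ) : ((hcos x : ℚ) : ℝ) = hcos (x : ℝ) := by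
  unfold hcos; push_cast; rfl

/-- `quot` commutes with the cast. [folklore] -/
theorem quot_cast (a b : ℚ) : ((quot a b : ℚ) : ℝ) = quot (a : ℝ) (b : ℝ) := by
  unfold quot; push_cast; rfl

/-- `sinSub` commutes with the cast. [folklore] -/
theorem sinSub_cast (a b : ℚ) : ((sinSub a b : ℚ) : ℝ) = sinSub (a : ℝ) (b : ℝ) := by
  unfold sinSub hsin hcos; push_cast; rfl

/-- `flowQ` commutes with the cast. [folklore] -/
theorem flowQ_cast (src tgt : Fin m → Fin n) (w : Fin m → ℚ) (t : Fin n → ℚ) (i : Fin n) :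
    ((flowQ src tgt w t i : ℚ) : ℝ) = flowQ src tgt (fun e => (w e : ℝ)) (fun j => (t j : ℝ)) i := by
  unfold flowQ
  push_cast
  refine Finset.sum_congr rfl fun e _ => ?_
  by_cases h1 : src e = i <;> by_cases h2 : tgt e = i <;> simp [h1, h2, sinSub_cast]

/-- `lapQ` commutes with the cast. [folklore] -/
theorem lapQ_cast (src tgt : Fin m → Fin n) (w : Fin m → ℚ) (x : Fin n → ℚ) (i : Fin n) :
    ((lapQ src tgt w x i : ℚ) : ℝ) = lapQ src tgt (fun e => (w e : ℝ)) (fun j => (x j : ℝ)) i := by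
  unfold lapQ
  push_cast
  refine Finset.sum_congr rfl fun e _ => ?_
  by_cases h1 : src e = i <;> by_cases h2 : tgt e = i <;> simp [h1, h2]

/-- `hcos τ = cos(2·arctan τ)`. [folklore] -/
theorem hcos_eq_cos (τ : ℝ) : hcos τ = Real.cos (2 * Real.arctan τ) := by
  rw [cos_two_mul_arctan]; rfl

/-- `hsin τ = sin(2·arctan τ)`. [folklore] -/
theorem hsin_eq_sin (τ : ℝ) : hsin τ = Real.sin (2 * Real.arctan τ) := by
  rw [sin_two_mul_arctan]; rfl

/-- `sinSub (t i) (t j) = sin(δᵢ − δⱼ)` at the half-angle point `δ = halfAngle t`. [folklore] -/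
theorem sinSub_eq_sin (t : Fin n → ℝ) (i j : Fin n) :
    sinSub (t i) (t j) = Real.sin (halfAngle t i - halfAngle t j) := by
  rw [Real.sin_sub, sin_halfAngle, cos_halfAngle, sin_halfAngle, cos_halfAngle]
  rfl

/-- **Edge re-indexing of a coupling sum**: for couplings read off an indexed edge list,
`Σⱼ bᵢⱼ g j = Σₑ wₑ([src e = i] g(tgt e) + [tgt e = i] g(src e))`. [folklore] -/
theorem sum_symmetrize_mul (src tgt : Fin m → Fin n) (w : Fin m → ℝ) (g : Fin n → ℝ) (i : Fin n) :
    ∑ j, symmetrize (edgeWeight src tgt w) i j * g j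
      = ∑ e, w e * ((if src e = i then g (tgt e) else 0) + (if tgt e = i then g (src e) else 0)) := by
  have h1 : ∑ j, edgeWeight src tgt w i j * g j = ∑ e, w e * (if src e = i then g (tgt e) else 0) := by
    unfold edgeWeight
    simp_rw [Finset.sum_mul]
    rw [Finset.sum_comm]
    refine Finset.sum_congr rfl fun e _ => ?_
    by_cases hs : src e = i
    · simp only [hs, true_and, ite_mul, zero_mul, if_true]
      rw [Finset.sum_ite_eq]; simp
    · simp [hs]
  have h2 : ∑ j, edgeWeight src tgt w j i * g j = ∑ e, w e * (if tgt e = i then g (src e) else 0) := by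
    unfold edgeWeight
    simp_rw [Finset.sum_mul]
    rw [Finset.sum_comm]
    refine Finset.sum_congr rfl fun e _ => ?_
    by_cases ht : tgt e = i
    · simp only [ht, and_true, ite_mul, zero_mul, if_true]
      rw [Finset.sum_ite_eq]; simp
    · simp [ht]
  unfold symmetrize
  simp_rw [add_mul, Finset.sum_add_distrib, h1, h2, ← Finset.sum_add_distrib, ← mul_add]

/-- **The injections at a half-angle point are `flowQ`** (exact): `fᵢ(halfAngle t) = flowQ … i` for
`b = symmetrize (edgeWeight src tgt w)`. [folklore] -/
theorem pe_halfAngle_eq_flowQ (src tgt : Fin m → Fin n) (w : Fin m → ℝ) (t : Fin n → ℝ)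
    (i : Fin n) :
    ∑ j, symmetrize (edgeWeight src tgt w) i j * Real.sin (halfAngle t i - halfAngle t j)
      = flowQ src tgt w t i := by
  rw [sum_symmetrize_mul]
  unfold flowQ
  refine Finset.sum_congr rfl fun e _ => ?_
  by_cases h1 : src e = i <;> by_cases h2 : tgt e = i <;> simp [h1, h2, sinSub_eq_sin]

/-- **The Laplacian action is `lapQ`**: `Σⱼ bᵢⱼ(xᵢ − xⱼ) = lapQ … i`. [folklore] -/
theorem laplacian_eq_lapQ (src tgt : Fin m → Fin n) (w : Fin m → ℝ) (x : Fin n → ℝ) (i : Fin n) :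
    ∑ j, symmetrize (edgeWeight src tgt w) i j * (x i - x j) = lapQ src tgt w x i := by
  rw [sum_symmetrize_mul]
  rfl

/-! ### Two scalar lemmas on `arctan` -/

/-- `R(1 + u²) ≤ u` with `u ≥ 0` gives `R ≤ arctan u` (`u/(1 + u²) = sin y cos y ≤ sin y ≤ y` at
`y = arctan u`). [folklore] -/
theorem le_arctan_of_mul_le {R u : ℝ} (hu : 0 ≤ u) (h : R * (1 + u ^ 2) ≤ u) : R ≤ Real.arctan u := by
  have hpos : 0 < 1 + u ^ 2 := by positivity
  have hy0 : 0 ≤ Real.arctan u := by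
    have := Real.arctan_strictMono.monotone hu
    rwa [Real.arctan_zero] at this
  have hsc : Real.sin (Real.arctan u) * Real.cos (Real.arctan u) = u / (1 + u ^ 2) := by
    rw [Real.sin_arctan, Real.cos_arctan]
    field_simp
    rw [Real.sq_sqrt hpos.le]
  have h1 : R ≤ u / (1 + u ^ 2) := by rw [le_div_iff₀ hpos]; exact h
  have h2 : Real.sin (Real.arctan u) * Real.cos (Real.arctan u) ≤ Real.sin (Real.arctan u) := by
    have hs0 : 0 ≤ Real.sin (Real.arctan u) := Real.sin_arctan_nonneg.mpr hu
    have hc1 : Real.cos (Real.arctan u) ≤ 1 := Real.cos_le_one _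
    nlinarith
  have h3 : Real.sin (Real.arctan u) ≤ Real.arctan u := Real.sin_le hy0
  linarith [hsc]

/-- `|arctan d| ≤ |d|` (`y ≤ tan y` on `[0, π/2)`, oddness). [folklore] -/
theorem abs_arctan_le_abs (d : ℝ) : |Real.arctan d| ≤ |d| := by
  have key : ∀ u : ℝ, 0 ≤ u → Real.arctan u ≤ u := by
    intro u hu
    have hy0 : 0 ≤ Real.arctan u := by
      have := Real.arctan_strictMono.monotone hu
      rwa [Real.arctan_zero] at this
    have h := Real.le_tan hy0 (Real.arctan_lt_pi_div_two u)
    rwa [Real.tan_arctan] at h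
  rcases le_total 0 d with hd | hd
  · have h0 : 0 ≤ Real.arctan d := by
      have := Real.arctan_strictMono.monotone hd
      rwa [Real.arctan_zero] at this
    rw [abs_of_nonneg h0, abs_of_nonneg hd]
    exact key d hd
  · have h0 : Real.arctan d ≤ 0 := by
      have := Real.arctan_strictMono.monotone hd
      rwa [Real.arctan_zero] at this
    rw [abs_of_nonpos h0, abs_of_nonpos hd]
    have := key (-d) (by linarith)
    rw [Real.arctan_neg] at this
    exact this

/-! ### Edge-list plumbing -/

/-- A nonzero coupling `bᵢⱼ` of edge-list data is witnessed by a listed edge of NONZERO weight joining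
`i` and `j` (in one of the two orientations). [folklore] -/
theorem exists_ne_zero_edge (src tgt : Fin m → Fin n) (w : Fin m → ℝ) {i j : Fin n}
    (hne : symmetrize (edgeWeight src tgt w) i j ≠ 0) :
    ∃ e, w e ≠ 0 ∧ ((src e = i ∧ tgt e = j) ∨ (src e = j ∧ tgt e = i)) := by
  classical
  by_contra h
  have h' : ∀ e, w e ≠ 0 → ¬((src e = i ∧ tgt e = j) ∨ (src e = j ∧ tgt e = i)) :=
    fun e he hij => h ⟨e, he, hij⟩
  apply hne
  unfold symmetrize edgeWeight
  rw [Finset.sum_eq_zero, Finset.sum_eq_zero, add_zero]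
  · intro e _
    by_cases hw : w e = 0
    · simp [hw]
    · rw [if_neg fun hij => h' e hw (Or.inr hij)]
  · intro e _
    by_cases hw : w e = 0
    · simp [hw]
    · rw [if_neg fun hij => h' e hw (Or.inl hij)]

/-- Without self-loops in the edge list the diagonal couplings vanish: `bᵢᵢ = 0`. [folklore] -/
theorem symmetrize_edgeWeight_self (src tgt : Fin m → Fin n) (w : Fin m → ℝ)
    (hloop : ∀ e, src e ≠ tgt e) (i : Fin n) : symmetrize (edgeWeight src tgt w) i i = 0 := by
  unfold symmetrize
  rw [edgeWeight_eq_zero fun e h => hloop e (h.1.trans h.2.symm), add_zero]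

/-- **Double coupling sums over an edge list**: for a symmetric summand `F`,
`½ΣᵢΣⱼ bᵢⱼ F i j = Σₑ wₑ F(src e)(tgt e)`. [folklore] -/
theorem half_sum_symmetrize (src tgt : Fin m → Fin n) (w : Fin m → ℝ) (F : Fin n → Fin n → ℝ)
    (hF : ∀ i j, F i j = F j i) :
    1 / 2 * ∑ i, ∑ j, symmetrize (edgeWeight src tgt w) i j * F i j = ∑ e, w e * F (src e) (tgt e) := by
  classical
  calc 1 / 2 * ∑ i, ∑ j, symmetrize (edgeWeight src tgt w) i j * F i j
      = 1 / 2 * ∑ i, ∑ e, w e * ((if src e = i then F i (tgt e) else 0)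
          + (if tgt e = i then F i (src e) else 0)) := by
        congr 1
        exact Finset.sum_congr rfl fun i _ => sum_symmetrize_mul src tgt w (F i) i
    _ = 1 / 2 * ∑ e, ∑ i, w e * ((if src e = i then F i (tgt e) else 0)
          + (if tgt e = i then F i (src e) else 0)) := by rw [Finset.sum_comm]
    _ = 1 / 2 * ∑ e, (w e * F (src e) (tgt e) + w e * F (tgt e) (src e)) := by
        congr 1
        refine Finset.sum_congr rfl fun e _ => ?_
        rw [← Finset.mul_sum, Finset.sum_add_distrib, Finset.sum_ite_eq, Finset.sum_ite_eq]
        simp [mul_add]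
    _ = ∑ e, w e * F (src e) (tgt e) := by
        rw [Finset.mul_sum]
        exact Finset.sum_congr rfl fun e _ => by rw [hF (tgt e)]; ring

end Summit.Ventures.GridStability.Lyapunov.StructurePreserving.Switch

end
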